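import Mathlib
import HarnessLib
import Literature.MathematicalPhysics.QuantumLattice.GaugeGroups
import Literature.MathematicalPhysics.QuantumFieldTheory.ConstructiveQFTWave0
import Literature.MathematicalPhysics.QuantumFieldTheory.U1GinibreComparison
import Summits.Ventures.LatticeQCDFlow.Scaling.PlaquetteMarginals2D
import Summits.Ventures.LatticeQCDFlow.Scaling.FluxTunnellingU1Explicit
import Summits.Ventures.LatticeQCDFlow.Scaling.ConvolutionPowerCompensation
import Summits.Ventures.LatticeQCDFlow.Scaling.WilsonPatchLowerBound

/-!
# LatticeQCDFlow / Scaling — the 2-d `U(1)` Wilson law of a patch is AT MOST the product law's, up to the same volume-vanishing factor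

HONEST FRAMING: exact (Metropolis-corrected) sampling algorithms for lattice gauge theory; figures of merit are
autocorrelation/cost numbers at stated couplings and volumes; no continuum-physics claim.

Venture `LatticeQCDFlow` (cell pub-lqcd), topic `Scaling`, FANOUT row 30 (lean-1) — OUR WORK, the UPPER companion of
theory-2's `Scaling/WilsonPatchLowerBound.lean` (item 102, `u1_lintegral_patch_ge`: the Wilson law of a patch
DOMINATES the product of one-plaquette laws up to `ρ_{L,#P}(β) = e^{−β(L²−#P)(1−cos(π/(L²−#P−1)))} → 1`).  With the
same factor on the other side, EVERY patch expectation of the two-dimensional `U(1)` Wilson measure is pinned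
within `ρ^{±1}` of its value under INDEPENDENT one-plaquette laws `ν_β = w_β dHaar/z₁(β)`:

* `lintegral_weight_mul_ge` — (abelian `G`, any symmetric measurable weight `w`) the INF companion of lean-1's sup
  bound `PlaquetteMarginals2D.lintegral_weight_mul_le`: `M ≤ K_w^{L²−1−#P} w` pointwise ⟹
  `M·∫ f·∏_{x∈P} w(g_x) dHaar^{⊗Λ} ≤ ∫ f(U_·)·∏_x w(U_x) dHaar^{⊗E}`;
* **`u1_lintegral_patch_le`** — for `L ≥ 2`, `β ≥ 0`, `#P + 3 ≤ L²` and `f ≥ 0` measurable depending only on the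
  plaquettes in `P`: `ρ_{L,#P}(β)·z₁(β)^{#P}·∫ f(U_·) dμ_{β,L} ≤ ∫ f·∏_{x∈P} w_β(g_x) dHaar^{⊗Λ}`;
* `lintegral_pair_prod_u1W` — the product-law integral of a pair observable factorises (`p ≠ p'`);
* **`u1_pair_lintegral_le`**, **`u1_pair_lintegral_ge`** — the PAIR case `P = {p, p'}`, any two distinct sites,
  `L ≥ 3`: `ρ_{L,2}(β)·∫ Φ(U_p)Ψ(U_{p'}) dμ_{β,L} ≤ ν_β(Φ)ν_β(Ψ)` and `ρ_{L,2}(β)·ν_β(Φ)ν_β(Ψ) ≤ ∫ Φ(U_p)Ψ(U_{p'}) dμ_{β,L}`;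
  `lintegral_u1W_div` — `ν_β(1) = 1`.

PROOF: lean-1's puncture formula (`PlaquetteMarginals2D.lintegral_weight_mul_eq_iterate`: off one puncture the
plaquettes of the abelian 2-torus are free and the closing plaquette contributes the Haar-convolution power
`(K_w^{L²−1−#P} w)(∏_P g_x)`) for the numerator AND for `Z` (with `f = 1` and the same `P`), and theory-2's
two-sided level `ρ·s ≤ K_wᵐ w ≤ s` (`ConvolutionPowerCompensation.iterate_two_sided`): numerator `≤ s·I(f)`,
`Z ≥ ρ·s·z₁^{#P}`, the unknown level `s` cancels.  Used by `Scaling/PlaquetteDecorrelationTwoDimU1.lean` (the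
covariance of any two plaquette observables is `O(ρ⁻² − ρ) → 0`, uniformly in the sites) and
`Scaling/CorrelatorFloorTwoDimU1.lean` ((U′)/(U″) are FALSE in `d = 2`).  Elementary given the tree; nothing here is
cited as a fact; no `def`, no `sorry`.
-/

noncomputable section

namespace Summit.Ventures.LatticeQCDFlow.Theory2.Lattice.TwoDim

open MeasureTheory Filter Topology Literature.MathematicalPhysics.QuantumFieldTheory
open Literature.MathematicalPhysics.QuantumLattice
open Summit.Ventures.LatticeQCDFlow.Theory2.HaarConv
open scoped ENNReal

/-! ## §1. The inf companion of the sup bound (abelian `G`, any symmetric weight) -/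

section Abelian

variable {L : ℕ} {G : Type*} [CommGroup G] [TopologicalSpace G] [IsTopologicalGroup G] [CompactSpace G]
  [SecondCountableTopology G] [MeasurableSpace G] [BorelSpace G]

/-- **INF BOUND** (companion of `lintegral_weight_mul_le`): `M·∫ f·∏_{x∈P} w(g_x) dHaar^{⊗Λ} ≤ ∫ f(U_·)·∏_x w(U_x) dHaar^{⊗E}`
whenever `M ≤ K_w^{L²−1−#P} w` pointwise. [folklore] -/
theorem lintegral_weight_mul_ge [NeZero L] (hL : 2 ≤ L) {w : G → ℝ≥0∞} (hw : Measurable w)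
    (hws : ∀ g, w g⁻¹ = w g) (x₀ : Site 2 L) (P : Finset (Site 2 L)) (hP : x₀ ∉ P)
    {f : (Site 2 L → G) → ℝ≥0∞} (hfm : Measurable f)
    (hf : ∀ g g' : Site 2 L → G, (∀ x ∈ P, g x = g' x) → f g = f g') {M : ℝ≥0∞}
    (hM : ∀ u, M ≤ (haarConv w)^[((Finset.univ.erase x₀) \ P).card] w u) :
    M * ∫⁻ g, f g * ∏ x ∈ P, w (g x) ∂(Measure.pi fun _ : Site 2 L => haarProbability G) ≤
      ∫⁻ U, f (fun x => plaquetteHolonomy U x 0 1) * ∏ x, w (plaquetteHolonomy U x 0 1)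
        ∂(Measure.pi fun _ : Edge 2 L => haarProbability G) := by
  have hmeas : Measurable (fun g : Site 2 L → G => f g * ∏ x ∈ P, w (g x)) :=
    hfm.mul (Finset.measurable_prod _ fun i _ => hw.comp (measurable_pi_apply i))
  rw [lintegral_weight_mul_eq_iterate hL hw hws x₀ P hP hfm hf, ← lintegral_const_mul _ hmeas]
  refine lintegral_mono fun g => ?_
  rw [mul_comm M]
  exact mul_le_mul_right (hM _) _

end Abelian

/-! ## §2. `U(1)`: the Wilson law of a patch is within `ρ^{±1}` of the product law -/

section U1

variable {L : ℕ}

/-- **THE PRODUCT LAW DOMINATES THE WILSON LAW OF A PATCH, up to the same volume-vanishing factor** (2-d `U(1)`,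
every `L`, `β ≥ 0`, `#P + 3 ≤ L²`; UPPER companion of `u1_lintegral_patch_ge`): for `f ≥ 0` measurable depending
only on the plaquettes in `P`,
`e^{−β(L²−#P)(1−cos(π/(L²−#P−1)))}·z₁(β)^{#P}·∫ f(U_·) dμ_{β,L} ≤ ∫ f·∏_{x∈P} w_β(g_x) dHaar^{⊗Λ}`. [folklore] -/
theorem u1_lintegral_patch_le [NeZero L] (hL : 2 ≤ L) {β : ℝ} (hβ : 0 ≤ β) (P : Finset (Site 2 L))
    (hP : P.card + 3 ≤ L ^ 2) {f : (Site 2 L → Circle) → ℝ≥0∞} (hfm : Measurable f)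
    (hf : ∀ g g' : Site 2 L → Circle, (∀ x ∈ P, g x = g' x) → f g = f g') :
    ENNReal.ofReal (Real.exp (-(β * (((L ^ 2 - P.card : ℕ) : ℝ) *
        (1 - Real.cos (Real.pi / ((L ^ 2 - P.card - 1 : ℕ) : ℝ))))))) *
      (z1 u1Rep β ^ P.card *
        ∫⁻ U, f (fun x => plaquetteHolonomy U x 0 1) ∂(wilsonMeasure (d := 2) (L := L) u1Rep β)) ≤
    ∫⁻ g, f g * ∏ x ∈ P, u1W β (g x) ∂(Measure.pi fun _ : Site 2 L => haarProbability Circle) := by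
  classical
  have hw : Measurable (u1W β) := measurable_u1W β
  have hws : ∀ g, u1W β g⁻¹ = u1W β g := u1W_symm β
  -- a puncture off `P`
  have hcardU : (Finset.univ : Finset (Site 2 L)).card = L ^ 2 := by
    rw [Finset.card_univ, Fintype.card_fun, ZMod.card, Fintype.card_fin]
  have hcard : P.card < (Finset.univ : Finset (Site 2 L)).card := by rw [hcardU]; omega
  obtain ⟨x₀, -, hx₀⟩ := Finset.exists_mem_notMem_of_card_lt_card hcard
  have hPsub : P ⊆ Finset.univ.erase x₀ := fun x hx =>
    Finset.mem_erase.mpr ⟨fun h => hx₀ (h ▸ hx), Finset.mem_univ _⟩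
  set m := ((Finset.univ.erase x₀) \ P).card with hmdef
  have hm : m = L ^ 2 - 1 - P.card := by
    rw [hmdef, Finset.card_sdiff_of_subset hPsub, Finset.card_erase_of_mem (Finset.mem_univ _), hcardU]
  have hm1 : 1 ≤ m := by rw [hm]; omega
  -- the two-sided level
  obtain ⟨s, hs0, hs1, hup, hlow⟩ := iterate_two_sided hβ hm1
  have hst : s ≠ ⊤ := ne_top_of_le_ne_top ENNReal.one_ne_top hs1
  set ρ : ℝ≥0∞ := ENNReal.ofReal (Real.exp (-(β * ((m + 1 : ℝ) * (1 - Real.cos (Real.pi / m))))))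
    with hρdef
  have hρeq : ENNReal.ofReal (Real.exp (-(β * (((L ^ 2 - P.card : ℕ) : ℝ) *
      (1 - Real.cos (Real.pi / ((L ^ 2 - P.card - 1 : ℕ) : ℝ))))))) = ρ := by
    have h1 : ((L ^ 2 - P.card : ℕ) : ℝ) = m + 1 := by
      rw [hm, show L ^ 2 - P.card = (L ^ 2 - 1 - P.card) + 1 by omega]; push_cast; ring
    have h2 : ((L ^ 2 - P.card - 1 : ℕ) : ℝ) = m := by
      rw [hm, show L ^ 2 - P.card - 1 = L ^ 2 - 1 - P.card by omega]
    rw [h1, h2]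
  have hρ0 : ρ ≠ 0 := (ENNReal.ofReal_pos.mpr (Real.exp_pos _)).ne'
  have hρt : ρ ≠ ⊤ := ENNReal.ofReal_ne_top
  -- `Z` and the numerator through the puncture formula
  have hdens : Measurable fun U : GaugeConfig 2 L Circle =>
      ENNReal.ofReal (Real.exp (-β * wilsonAction u1Rep U)) := by
    have h : (fun U : GaugeConfig 2 L Circle => ENNReal.ofReal (Real.exp (-β * wilsonAction u1Rep U))) =
        fun U => ∏ x, u1W β (plaquetteHolonomy U x 0 1) := funext (weight_eq_prod_two u1Rep β)
    rw [h]
    exact Finset.measurable_prod _ fun x _ => hw.comp (measurable_plaquetteHolonomy x)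
  have hfhol : Measurable fun U : GaugeConfig 2 L Circle => f (fun x => plaquetteHolonomy U x 0 1) :=
    hfm.comp (measurable_pi_lambda _ fun x => measurable_plaquetteHolonomy x)
  have hZ : partitionFunction (d := 2) (L := L) u1Rep β =
      ∫⁻ U, (fun _ => (1 : ℝ≥0∞)) (fun x => plaquetteHolonomy U x 0 1) *
        ∏ x, u1W β (plaquetteHolonomy U x 0 1) ∂(Measure.pi fun _ : Edge 2 L => haarProbability Circle) := by
    unfold partitionFunction wilsonWeight
    rw [withDensity_apply _ MeasurableSet.univ, Measure.restrict_univ]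
    refine lintegral_congr fun U => ?_
    rw [weight_eq_prod_two u1Rep β U, one_mul]; rfl
  have hZge : ρ * s * z1 u1Rep β ^ P.card ≤ partitionFunction (d := 2) (L := L) u1Rep β := by
    rw [hZ, ← lintegral_prod_u1W_eq_pow β P, mul_assoc]
    have h := lintegral_weight_mul_ge hL hw hws x₀ P hx₀ (f := fun _ => (1 : ℝ≥0∞)) measurable_const
      (fun _ _ _ => rfl) (M := ρ * s) hlow
    simpa only [one_mul, mul_assoc] using h
  have hnum : ∫⁻ U, f (fun x => plaquetteHolonomy U x 0 1) * ∏ x, u1W β (plaquetteHolonomy U x 0 1)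
        ∂(Measure.pi fun _ : Edge 2 L => haarProbability Circle) ≤
      s * ∫⁻ g, f g * ∏ x ∈ P, u1W β (g x) ∂(Measure.pi fun _ : Site 2 L => haarProbability Circle) :=
    lintegral_weight_mul_le hL hw hws x₀ P hx₀ hfm hf hup
  -- the Wilson integral as `Z⁻¹ · numerator`
  have hint : ∫⁻ U, f (fun x => plaquetteHolonomy U x 0 1) ∂(wilsonMeasure (d := 2) (L := L) u1Rep β) =
      (partitionFunction (d := 2) (L := L) u1Rep β)⁻¹ *
        ∫⁻ U, f (fun x => plaquetteHolonomy U x 0 1) * ∏ x, u1W β (plaquetteHolonomy U x 0 1)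
          ∂(Measure.pi fun _ : Edge 2 L => haarProbability Circle) := by
    unfold wilsonMeasure
    rw [lintegral_smul_measure]
    congr 1
    unfold wilsonWeight
    rw [lintegral_withDensity_eq_lintegral_mul _ hdens hfhol]
    refine lintegral_congr fun U => ?_
    rw [Pi.mul_apply, weight_eq_prod_two u1Rep β U, mul_comm]; rfl
  -- assemble: `ρ z₁^#P Z⁻¹ N ≤ ρ z₁^#P (ρ s z₁^#P)⁻¹ (s I) = I`
  rw [hρeq, hint]
  set I := ∫⁻ g, f g * ∏ x ∈ P, u1W β (g x) ∂(Measure.pi fun _ : Site 2 L => haarProbability Circle)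
  set Z := partitionFunction (d := 2) (L := L) u1Rep β
  have hz0 : z1 u1Rep β ^ P.card ≠ 0 := pow_ne_zero _ (z1_u1_ne_zero β)
  have hzt : z1 u1Rep β ^ P.card ≠ ⊤ :=
    ENNReal.pow_ne_top (ne_top_of_le_ne_top ENNReal.one_ne_top (z1_u1_le_one hβ))
  have hc0 : ρ * s * z1 u1Rep β ^ P.card ≠ 0 := mul_ne_zero (mul_ne_zero hρ0 hs0) hz0
  have hct : ρ * s * z1 u1Rep β ^ P.card ≠ ⊤ := ENNReal.mul_ne_top (ENNReal.mul_ne_top hρt hst) hzt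
  calc ρ * (z1 u1Rep β ^ P.card * (Z⁻¹ * ∫⁻ U, f (fun x => plaquetteHolonomy U x 0 1) *
          ∏ x, u1W β (plaquetteHolonomy U x 0 1) ∂(Measure.pi fun _ : Edge 2 L => haarProbability Circle)))
      ≤ ρ * (z1 u1Rep β ^ P.card * ((ρ * s * z1 u1Rep β ^ P.card)⁻¹ * (s * I))) := by
        have hZinv : Z⁻¹ ≤ (ρ * s * z1 u1Rep β ^ P.card)⁻¹ := ENNReal.inv_le_inv.mpr hZge
        gcongr
    _ = (ρ * s * z1 u1Rep β ^ P.card) * (ρ * s * z1 u1Rep β ^ P.card)⁻¹ * I := by ring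
    _ = I := by rw [ENNReal.mul_inv_cancel hc0 hct, one_mul]

/-- The product-law integral of a PAIR observable factorises:
`∫ Φ(g_p)Ψ(g_{p'})·w_β(g_p)w_β(g_{p'}) dHaar^{⊗Λ} = (∫ Φ w_β dHaar)·(∫ Ψ w_β dHaar)` (`p ≠ p'`). [folklore] -/
theorem lintegral_pair_prod_u1W [NeZero L] (β : ℝ) {p p' : Site 2 L} (hpp' : p ≠ p')
    {Φ Ψ : Circle → ℝ≥0∞} (hΦ : Measurable Φ) (hΨ : Measurable Ψ) :
    ∫⁻ g, Φ (g p) * Ψ (g p') * ∏ x ∈ ({p, p'} : Finset (Site 2 L)), u1W β (g x)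
        ∂(Measure.pi fun _ : Site 2 L => haarProbability Circle) =
      (∫⁻ u, Φ u * u1W β u ∂(haarProbability Circle)) * ∫⁻ u, Ψ u * u1W β u ∂(haarProbability Circle) := by
  classical
  -- the integrand as a product over all coordinates
  let F : Site 2 L → Circle → ℝ≥0∞ := fun i u =>
    if i = p then Φ u * u1W β u else if i = p' then Ψ u * u1W β u else 1
  have hF : ∀ i, Measurable (F i) := by
    intro i
    by_cases hip : i = p
    · simp only [F, hip, if_true]; exact hΦ.mul (measurable_u1W β)
    · by_cases hip' : i = p'
      · simp only [F, hip', hpp'.symm, if_false, if_true]; exact hΨ.mul (measurable_u1W β)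
      · simp only [F, hip, hip', if_false]; exact measurable_const
  have hprod : ∀ g : Site 2 L → Circle,
      Φ (g p) * Ψ (g p') * ∏ x ∈ ({p, p'} : Finset (Site 2 L)), u1W β (g x) = ∏ i, F i (g i) := by
    intro g
    have hsupp : ∀ i, i ∉ ({p, p'} : Finset (Site 2 L)) → F i (g i) = 1 := by
      intro i hi
      rw [Finset.mem_insert, Finset.mem_singleton, not_or] at hi
      simp only [F, hi.1, hi.2, if_false]
    rw [← Finset.prod_subset (Finset.subset_univ ({p, p'} : Finset (Site 2 L))) (fun i _ hi => hsupp i hi),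
      Finset.prod_pair hpp', Finset.prod_pair hpp']
    simp only [F, if_true, hpp'.symm, if_false]
    ring
  have hint : ∀ i, ∫⁻ u, F i u ∂(haarProbability Circle) =
      if i = p then ∫⁻ u, Φ u * u1W β u ∂(haarProbability Circle)
      else if i = p' then ∫⁻ u, Ψ u * u1W β u ∂(haarProbability Circle) else 1 := by
    intro i
    by_cases hip : i = p
    · simp only [F, hip, if_true]
    · by_cases hip' : i = p'
      · simp only [F, hip', hpp'.symm, if_false, if_true]
      · simp only [F, hip, hip', if_false, lintegral_const, measure_univ, mul_one]
  simp_rw [hprod]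
  rw [GaussianToolkit.lintegral_fintype_prod_eq_prod (fun _ : Site 2 L => haarProbability Circle) hF]
  simp_rw [hint]
  rw [← Finset.prod_subset (Finset.subset_univ ({p, p'} : Finset (Site 2 L))) (fun i _ hi => by
      rw [Finset.mem_insert, Finset.mem_singleton, not_or] at hi
      simp only [hi.1, hi.2, if_false]),
    Finset.prod_pair hpp']
  simp only [if_true, hpp'.symm, if_false]

/-! ## §3. Pair observables: two-sided bounds against the product one-plaquette law -/

/-- **PAIR, UPPER**: for sites `p ≠ p'` of `(ℤ/L)²`, `L ≥ 3`, `β ≥ 0` and measurable `Φ, Ψ ≥ 0`,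
`ρ_{L,2}(β)·∫ Φ(U_p)Ψ(U_{p'}) dμ_{β,L} ≤ ν_β(Φ)·ν_β(Ψ)`, `ν_β = w_β dHaar/z₁(β)` the one-plaquette law,
`ρ_{L,2}(β) = e^{−β(L²−2)(1−cos(π/(L²−3)))}`. [folklore] -/
theorem u1_pair_lintegral_le [NeZero L] (hL : 3 ≤ L) {β : ℝ} (hβ : 0 ≤ β) {p p' : Site 2 L} (hpp' : p ≠ p')
    {Φ Ψ : Circle → ℝ≥0∞} (hΦ : Measurable Φ) (hΨ : Measurable Ψ) :
    ENNReal.ofReal (Real.exp (-(β * (((L ^ 2 - 2 : ℕ) : ℝ) *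
        (1 - Real.cos (Real.pi / ((L ^ 2 - 2 - 1 : ℕ) : ℝ))))))) *
      ∫⁻ U, Φ (plaquetteHolonomy U p 0 1) * Ψ (plaquetteHolonomy U p' 0 1)
        ∂(wilsonMeasure (d := 2) (L := L) u1Rep β) ≤
    ((∫⁻ u, Φ u * u1W β u ∂(haarProbability Circle)) / z1 u1Rep β) *
      ((∫⁻ u, Ψ u * u1W β u ∂(haarProbability Circle)) / z1 u1Rep β) := by
  have hL2 : 2 ≤ L := by omega
  have hcard : ({p, p'} : Finset (Site 2 L)).card = 2 := Finset.card_pair hpp'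
  have hP : ({p, p'} : Finset (Site 2 L)).card + 3 ≤ L ^ 2 := by rw [hcard]; nlinarith
  have hfm : Measurable fun g : Site 2 L → Circle => Φ (g p) * Ψ (g p') :=
    (hΦ.comp (measurable_pi_apply p)).mul (hΨ.comp (measurable_pi_apply p'))
  have hf : ∀ g g' : Site 2 L → Circle, (∀ x ∈ ({p, p'} : Finset (Site 2 L)), g x = g' x) →
      Φ (g p) * Ψ (g p') = Φ (g' p) * Ψ (g' p') := fun g g' h => by
    rw [h p (by simp), h p' (by simp)]
  have h := u1_lintegral_patch_le hL2 hβ {p, p'} hP hfm hf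
  rw [hcard, lintegral_pair_prod_u1W β hpp' hΦ hΨ] at h
  set z := z1 u1Rep β
  have hz0 : z ≠ 0 := z1_u1_ne_zero β
  have hzt : z ≠ ⊤ := ne_top_of_le_ne_top ENNReal.one_ne_top (z1_u1_le_one hβ)
  have hz20 : z ^ 2 ≠ 0 := pow_ne_zero _ hz0
  have hz2t : z ^ 2 ≠ ⊤ := ENNReal.pow_ne_top hzt
  set X := ∫⁻ U, Φ (plaquetteHolonomy U p 0 1) * Ψ (plaquetteHolonomy U p' 0 1)
    ∂(wilsonMeasure (d := 2) (L := L) u1Rep β)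
  set ρ := ENNReal.ofReal (Real.exp (-(β * (((L ^ 2 - 2 : ℕ) : ℝ) *
        (1 - Real.cos (Real.pi / ((L ^ 2 - 2 - 1 : ℕ) : ℝ)))))))
  set a₀ := ∫⁻ u, Φ u * u1W β u ∂(haarProbability Circle)
  set b₀ := ∫⁻ u, Ψ u * u1W β u ∂(haarProbability Circle)
  calc ρ * X = (z ^ 2)⁻¹ * z ^ 2 * (ρ * X) := by rw [ENNReal.inv_mul_cancel hz20 hz2t, one_mul]
    _ = (z ^ 2)⁻¹ * (ρ * (z ^ 2 * X)) := by ring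
    _ ≤ (z ^ 2)⁻¹ * (a₀ * b₀) := by gcongr
    _ = (a₀ / z) * (b₀ / z) := by
        rw [div_eq_mul_inv, div_eq_mul_inv, pow_two, ENNReal.mul_inv (Or.inl hz0) (Or.inl hzt)]; ring

/-- **PAIR, LOWER**: `ρ_{L,2}(β)·ν_β(Φ)·ν_β(Ψ) ≤ ∫ Φ(U_p)Ψ(U_{p'}) dμ_{β,L}` (`p ≠ p'`, `L ≥ 3`, `β ≥ 0`). [folklore] -/
theorem u1_pair_lintegral_ge [NeZero L] (hL : 3 ≤ L) {β : ℝ} (hβ : 0 ≤ β) {p p' : Site 2 L} (hpp' : p ≠ p')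
    {Φ Ψ : Circle → ℝ≥0∞} (hΦ : Measurable Φ) (hΨ : Measurable Ψ) :
    ENNReal.ofReal (Real.exp (-(β * (((L ^ 2 - 2 : ℕ) : ℝ) *
        (1 - Real.cos (Real.pi / ((L ^ 2 - 2 - 1 : ℕ) : ℝ))))))) *
      (((∫⁻ u, Φ u * u1W β u ∂(haarProbability Circle)) / z1 u1Rep β) *
        ((∫⁻ u, Ψ u * u1W β u ∂(haarProbability Circle)) / z1 u1Rep β)) ≤
    ∫⁻ U, Φ (plaquetteHolonomy U p 0 1) * Ψ (plaquetteHolonomy U p' 0 1)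
      ∂(wilsonMeasure (d := 2) (L := L) u1Rep β) := by
  have hL2 : 2 ≤ L := by omega
  have hcard : ({p, p'} : Finset (Site 2 L)).card = 2 := Finset.card_pair hpp'
  have hP : ({p, p'} : Finset (Site 2 L)).card + 3 ≤ L ^ 2 := by rw [hcard]; nlinarith
  have hfm : Measurable fun g : Site 2 L → Circle => Φ (g p) * Ψ (g p') :=
    (hΦ.comp (measurable_pi_apply p)).mul (hΨ.comp (measurable_pi_apply p'))
  have hf : ∀ g g' : Site 2 L → Circle, (∀ x ∈ ({p, p'} : Finset (Site 2 L)), g x = g' x) →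
      Φ (g p) * Ψ (g p') = Φ (g' p) * Ψ (g' p') := fun g g' h => by
    rw [h p (by simp), h p' (by simp)]
  have h := u1_lintegral_patch_ge hL2 hβ {p, p'} hP hfm hf
  rw [hcard, lintegral_pair_prod_u1W β hpp' hΦ hΨ] at h
  set z := z1 u1Rep β
  have hz0 : z ≠ 0 := z1_u1_ne_zero β
  have hzt : z ≠ ⊤ := ne_top_of_le_ne_top ENNReal.one_ne_top (z1_u1_le_one hβ)
  have hz20 : z ^ 2 ≠ 0 := pow_ne_zero _ hz0
  have hz2t : z ^ 2 ≠ ⊤ := ENNReal.pow_ne_top hzt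
  set X := ∫⁻ U, Φ (plaquetteHolonomy U p 0 1) * Ψ (plaquetteHolonomy U p' 0 1)
    ∂(wilsonMeasure (d := 2) (L := L) u1Rep β)
  set ρ := ENNReal.ofReal (Real.exp (-(β * (((L ^ 2 - 2 : ℕ) : ℝ) *
        (1 - Real.cos (Real.pi / ((L ^ 2 - 2 - 1 : ℕ) : ℝ)))))))
  set a₀ := ∫⁻ u, Φ u * u1W β u ∂(haarProbability Circle)
  set b₀ := ∫⁻ u, Ψ u * u1W β u ∂(haarProbability Circle)
  calc ρ * (a₀ / z * (b₀ / z)) = (z ^ 2)⁻¹ * (ρ * (a₀ * b₀)) := by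
        rw [div_eq_mul_inv, div_eq_mul_inv, pow_two, ENNReal.mul_inv (Or.inl hz0) (Or.inl hzt)]; ring
    _ ≤ (z ^ 2)⁻¹ * (z ^ 2 * X) := by gcongr
    _ = X := by rw [← mul_assoc, ENNReal.inv_mul_cancel hz20 hz2t, one_mul]

/-- The product one-plaquette law is normalised: `(∫ w_β dHaar)/z₁(β) = 1` (`β ≥ 0`). [folklore] -/
theorem lintegral_u1W_div {β : ℝ} (hβ : 0 ≤ β) :
    (∫⁻ u, u1W β u ∂(haarProbability Circle)) / z1 u1Rep β = 1 := by
  rw [← z1_eq_lintegral_u1W]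
  exact ENNReal.div_self (z1_u1_ne_zero β) (ne_top_of_le_ne_top ENNReal.one_ne_top (z1_u1_le_one hβ))

end U1

end Summit.Ventures.LatticeQCDFlow.Theory2.Lattice.TwoDim

end
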